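import Summits.HubbardSuperconductivity.HubbardSuperconductivity.Theorems.AnisotropyChordTransferFibre3Hole2Quarter

/-!
# Route `AnisotropyChord` / H0 rotor rung: HOLE₂(.75) at `L = 32` — kernel facts, part c (38 of the 152 `D₄`-classes)

KERNEL FACT for the twice-punctured `32 × 32` torus (zero data): the quarter-table interval Birman–Schwinger checker `Hole2.checkRepsQ`
(`…Fibre3Hole2Quarter`) accepts the listed separations at the certified constant `g_32 ≥ ¾ε₁(32)`, by ONE `decide +kernel`
(`maxHeartbeats 400000` pre-budgeted: the quarter Green table alone is ¾L³ interval operations, recomputed in each part).  The parts are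
glued in `…Hole2L32` (`checkRepsQ_append`) and turned into `TwoHoleGap 32 (3/4·eps1 32)` by `Hole2.twoHoleGap_of_checkRepsQ`.
Prover seat `hubbard-h0-rotor-p3` g3; helper for stmt-HubbardSuperconductivity-19089 (`--supports`, helper class).
WHAT THIS IS NOT: nothing here proves superconductivity in the Hubbard model (rotor TARGET as worded stays FALSE, g15 verdict);
kernel facts for ONE input (HOLE₂(.75) at one `L`) of ONE conditional reduction (rung 19089). Tree imports only; no sorry, no `native_decide`.
-/

set_option linter.dupNamespace false
set_option autoImplicit false

namespace Summit.HubbardSuperconductivity.HubbardSuperconductivity.Theorems.AnisotropyChord.Transfer.Fibre3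

namespace Hole2

/-- `D₄`-representatives of the nonzero separations of the `32 × 32` torus, part c. [folklore] -/
def reps32c : List (ℕ × ℕ) := [(11, 11), (12, 0), (12, 1), (12, 2), (12, 3), (12, 4), (12, 5), (12, 6), (12, 7), (12, 8), (12, 9), (12, 10), (12, 11), (12, 12), (13, 0), (13, 1), (13, 2), (13, 3), (13, 4), (13, 5), (13, 6), (13, 7), (13, 8), (13, 9), (13, 10), (13, 11), (13, 12), (13, 13), (14, 0), (14, 1), (14, 2), (14, 3), (14, 4), (14, 5), (14, 6), (14, 7), (14, 8), (14, 9)]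

set_option maxHeartbeats 400000 in
/-- kernel fact: part c passes the quarter-table interval Birman–Schwinger test at `g_32 ≥ ¾ε₁(32)`. [folklore] -/
theorem checkRepsQ_32c : checkRepsQ 32 reps32c = true := by
  decide +kernel

end Hole2

end Summit.HubbardSuperconductivity.HubbardSuperconductivity.Theorems.AnisotropyChord.Transfer.Fibre3
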